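/-
Copyright (c) 2026 the pub-hodgecm-mathlib formalisation cell (harness21).  Prover seat hodgecm-mathlib-LH10-p01 (g11): road M6 → F3 → F5 (LEAD F0P3a-plan T15-32 «GO-LOW»),
brick (B2c-I) «ROW 0 IS A LEVEL-ONE PLACE COUNT» (2-free) for the (B3) F5 head of LH7-p04 (g12); 2026-09-03.
-/
import Literature.NumberTheory.Rogawski1990.DepthZeroKappaTransferTypeTwoStrataTotalPlaceCount   -- ★ (B2b-I) p853318: brings ★ B-p12's frame (`localNonsplitCongr`, `mem_cmLocalIntegralLevel_iff_conj_mem_glInt`), ★ (B2a), the strata sets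
import Literature.NumberTheory.Automorphic.UnitaryDepthZeroPieceOrbitalIntegral                  -- ★ `rank_redMat_conj_sub_one_eq`, `rank_redMat_coe_conj_sub_one_eq_iff`, `ncard_fixedBy_sep_congr`
import Literature.NumberTheory.Automorphic.FixedCosetsStableLattices                             -- ★ `mem_fixedBy_quotient_mk_iff`
import HarnessLib

/-!
# Row 0 of the depth-zero type-(2) socket is a level-one place count (2-free)

Topic `NumberTheory/Rogawski1990`; namespace `Literature.NumberTheory.Rogawski1990`.  ONE THEOREM (no definition, no instance, no notation, no named fact, no `sorry`); kernel lane
`--supports stmt-HodgeConjecture-24833`.  Cell `pub/hodgecm-mathlib` (D-0151), crux H413 = `stmt-HodgeConjecture-24833`; road M6 → F3 → F5 «2-free type-(2) G-side head»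
(LEAD F0P3a-plan T15-32), brick **(B2c-I)** — the ROW-0 twin of ★ (B2b-I) `sum_ncard_rankStrata_eq_ncard_isSelfDualLattice_stable_of_frame`: the residually-trivial
stratum of ★ O8b's fixed-vertex count, read as a lattice count WITH THE LEVEL-ONE CONDITION, in the shape ★ (W1) ED. 2 `cast_ncard_vertex_rowZero_eq_of_total` consumes.
HONEST LABEL: HC_CM is proved only modulo the 7 printed citations (2 remaining named inputs: hLiu418 = stmt-HodgeConjecture-24832, h413 = stmt-HodgeConjecture-24833) until rung 0
closes; count-neutral assembly of ★ bricks.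

THE MATHEMATICS.  For `δ ∈ G′_v = U(H′)(L⁺_v)` deep at the non-split place `w ∣ v` (unramified, ANY residue characteristic) and an integral frame `T` of `H′_w`
(`H′_w = ᵗ(σ_wT)·J₀·T`), the frame isomorphism `e : G′_v ≃ U(σ_w, J₀)(L_w)`, `e g = T g_w T⁻¹` (★ B-p12) carries `K_v` to `U ∩ GL₃(𝒪_w)` and — both sides being read on
`GL₃(𝒪_w)`-elements only — the Jordan rank `rank(red(q⁻¹δq)_w − 1)` to `rank(red((eq)⁻¹(eδ)(eq)) − 1)` (★ `rank_redMat_conj_sub_one_eq`, conjugation by `T⁻¹ ∈ GL₃(𝒪_w)`); on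
`U ⧸ (U ∩ GL₃(𝒪_w))` the fixed cosets with a conjugation-invariant predicate are the self-dual `eδ`-fixed lattices with the matching lattice predicate (★ the strata dictionary
`ncard_fixedBy_quotient_sep_eq_ncard_selfDual_fixed_sep`, 2-free: `L₀` self-dual, `U` transitive by ★ `exists_unitary_mapGL_stdLattice_eq_of_isSelfDualLattice_of_trace`), rank `0`
matching the LEVEL-ONE condition `(eδ − 1)M ⊆ ϖM` (★ `rank_redMat_sub_one_eq_zero_iff_map_sub_one_le`), and `eδ·M = M ⟺ eδ·M ⊆ M` (★ (B2a) `mapGL_eq_iff_map_le_of_charpoly_coeff_mem`,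
`χ_δ` integral):  `n₀(δ) = #{M : M J₀-self-dual, (Tδ_wT⁻¹)M ⊆ M, (Tδ_wT⁻¹ − 1)M ⊆ ϖM}`.
[cite: Rogawski1990, §4.9 p. 54, Prop. 4.9.1 (b) p. 55] [cite: Kottwitz1986BaseChangeUnits, §1 pp. 240–241] [cite: Flicker1998UnitaryFL, §3 Prop. 5 p. 82]

* **`ncard_rankStrata_zero_eq_ncard_isSelfDualLattice_stable_level_of_frame`**.

## References
* [Rogawski1990] J. D. Rogawski, *Automorphic Representations of Unitary Groups in Three Variables*, Ann. of Math. Stud. 123 (1990): §4.9 p. 54, Prop. 4.9.1 (b) p. 55.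
* [Kottwitz1986BaseChangeUnits] R. E. Kottwitz, *Base change for unit elements of Hecke algebras*, Compositio Math. 60 (1986): §1 pp. 240–241 (fixed cosets and stable lattices).
* [Flicker1998UnitaryFL] Y. Z. Flicker, *Elementary proof of the fundamental lemma for a unitary group*, Canad. J. Math. 50 (1998): §3 Prop. 5 p. 82.
-/

set_option autoImplicit false

noncomputable section

open NumberField IsDedekindDomain Matrix Polynomial
open scoped MatrixGroups WithZero ValuativeRel

namespace Literature.NumberTheory.Rogawski1990

open Literature.NumberTheory.Automorphic Literature.NumberTheory.Automorphic.UnitaryGroup Literature.NumberTheory.Automorphic.IntegralReduction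
open Literature.NumberTheory.Automorphic.UnitaryLatticeTree Literature.NumberTheory.Automorphic.HermitianLattice Literature.NumberTheory.GaloisRepresentations Literature.NumberTheory.NumberFields

variable (L : Type) [Field L] [NumberField L] [IsCMField L] (H' : Matrix (Fin 3) (Fin 3) L)
  {v : HeightOneSpectrum (𝓞 ↥(maximalRealSubfield L))}

set_option synthInstance.maxHeartbeats 200000 in
set_option maxHeartbeats 1600000 in
-- the strata set, the coset spaces of the one-place model and the lattice set are large terms (★ `…UnitRow` ∕ ★ (B2b-I) budgets)
open scoped Classical in
/-- **(B2c-I) ROW 0 IS A LEVEL-ONE PLACE COUNT (2-free).**  For `δ ∈ G′_v` deep at a non-split place `w ∣ v` UNRAMIFIED in `L` (any residue characteristic) and any frame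
`T ∈ GL₃(𝒪_w)` with `H′_w = ᵗ(σ_wT)·J₀·T`, `J₀ = antidiag(1,1,1)`:
`n₀(δ) = #{M ⊆ L_w³ : M a J₀-self-dual 𝒪_w-lattice, (Tδ_wT⁻¹)·M ⊆ M, (Tδ_wT⁻¹ − 1)·M ⊆ ϖ·M}` (the residually-trivial stratum of ★ `classOrbitalIntegral_eq_mul_strata_three_of_deep`;
right side = ★ (W1) ED. 2's level set). [cite: Rogawski1990, §4.9 p. 54, Prop. 4.9.1 (b) p. 55] [cite: Kottwitz1986BaseChangeUnits, §1 pp. 240–241] [cite: Flicker1998UnitaryFL, §3 Prop. 5 p. 82] -/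
theorem ncard_rankStrata_zero_eq_ncard_isSelfDualLattice_stable_level_of_frame (w : PlacesOver L v)
    (hw : IsCMField.complexConj L • w.1 = w.1) (hv : Algebra.IsUnramifiedIn (𝓞 L) v.asIdeal)
    (δ : (cmDatum L 3 H').Local v)
    (ht : ∀ m : ℕ, ValuativeRel.valuation (w.1.adicCompletion L)
      (((((δ.val : GL (Fin 3) (LocalRing L v)).val.map (Pi.evalRingHom (fun w' : UnitaryGroup.PlacesOver L v => w'.1.adicCompletion L) w))).charpoly -
        (Polynomial.X - 1) ^ 3).coeff m) < 1)
    (T : GL (Fin 3) (w.1.adicCompletion L)) (hTint : T ∈ glInt 3 (w.1.adicCompletion L))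
    (hJT : placeForm H' w.1 = formCongr (galAdicCompletionMap (L := L) (IsCMField.complexConj L) hw) T ((StdForm.antidiagonal 3).over (w.1.adicCompletion L)))
    {ϖ : w.1.adicCompletion L} (hϖ : Valued.v ϖ = WithZero.exp (-1 : ℤ)) :
    {q : (cmDatum L 3 H').Local v ⧸ cmLocalIntegralLevel L 3 H' v |
        q ∈ MulAction.fixedBy ((cmDatum L 3 H').Local v ⧸ cmLocalIntegralLevel L 3 H' v) δ ∧
          (redMat ((((q.out⁻¹ * δ * q.out : (cmDatum L 3 H').Local v)).val : GL (Fin 3) (LocalRing L v)).val.map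
            (Pi.evalRingHom (fun w' : UnitaryGroup.PlacesOver L v => w'.1.adicCompletion L) w)) - 1).rank = 0}.ncard =
      {M : Submodule (Valued.integer (w.1.adicCompletion L)) (Fin 3 → w.1.adicCompletion L) |
        IsSelfDualLattice (galAdicCompletionMap (L := L) (IsCMField.complexConj L) hw) ϖ ((StdForm.antidiagonal 3).over (w.1.adicCompletion L)) M ∧
          M.map ((Matrix.toLin' ((T : Matrix (Fin 3) (Fin 3) (w.1.adicCompletion L)) *
            ((δ.val : GL (Fin 3) (LocalRing L v)) : Matrix (Fin 3) (Fin 3) (LocalRing L v)).map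
              (Pi.evalRingHom (fun w' : UnitaryGroup.PlacesOver L v => w'.1.adicCompletion L) w) *
            ((T⁻¹ : GL (Fin 3) (w.1.adicCompletion L)) : Matrix (Fin 3) (Fin 3) (w.1.adicCompletion L)))).restrictScalars
              (Valued.integer (w.1.adicCompletion L))) ≤ M ∧
          M.map ((Matrix.toLin' ((T : Matrix (Fin 3) (Fin 3) (w.1.adicCompletion L)) *
            ((δ.val : GL (Fin 3) (LocalRing L v)) : Matrix (Fin 3) (Fin 3) (LocalRing L v)).map
              (Pi.evalRingHom (fun w' : UnitaryGroup.PlacesOver L v => w'.1.adicCompletion L) w) *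
            ((T⁻¹ : GL (Fin 3) (w.1.adicCompletion L)) : Matrix (Fin 3) (Fin 3) (w.1.adicCompletion L)) - 1)).restrictScalars
              (Valued.integer (w.1.adicCompletion L))) ≤ scaleLattice ϖ M}.ncard := by
  classical
  have hc1 : IsCMField.complexConj L ≠ 1 := IsCMField.complexConj_ne_one L
  haveI : Algebra.IsQuadraticExtension ↥(maximalRealSubfield L) L := IsCMField.isQuadraticExtension L
  haveI : IsAdicComplete (IsLocalRing.maximalIdeal (Valued.integer (w.1.adicCompletion L))) (Valued.integer (w.1.adicCompletion L)) :=
    isAdicComplete_maximalIdeal_valuedInteger_adicCompletion L w.1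
  set σ : w.1.adicCompletion L →+* w.1.adicCompletion L := galAdicCompletionMap (L := L) (IsCMField.complexConj L) hw with hσdef
  set ev := Pi.evalRingHom (fun w' : PlacesOver L v => w'.1.adicCompletion L) w with hev
  have hσσ : ∀ x, σ (σ x) = x := galAdicCompletionMap_galAdicCompletionMap_of_smul_eq (IsCMField.complexConj L) w hc1 hw
  have hvσ : ∀ x, Valued.v (σ x) = Valued.v x := fun x => valued_galAdicCompletionMap (L := L) (IsCMField.complexConj L) hw x
  -- ### (1) ★ B-p12 (α): the frame `e g = T g_w T⁻¹` onto the one-place model `U = U(σ_w, Φ₃)`, `K_v ↔ U ∩ GL₃(𝒪_w)`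
  have hF : formCongr σ T (placeForm (Matrix.of fun i j : Fin 3 => if i.val + j.val + 1 = 3 then (1 : L) else 0) w.1) =
      (1 : w.1.adicCompletion L) • placeForm H' w.1 := by
    rw [one_smul, placeForm_antidiagOne, ← hJT]
  set e := (localNonsplitCongr (IsCMField.complexConj L) hc1 w hw T isUnit_one hF).trans
    (localNonsplitEquiv (IsCMField.complexConj L) (Matrix.of fun i j : Fin 3 => if i.val + j.val + 1 = 3 then (1 : L) else 0) hc1 w hw) with he
  have hform : ∀ g, ((e g).val : GL (Fin 3) (w.1.adicCompletion L)) =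
      T * ((localNonsplitEquiv (IsCMField.complexConj L) H' hc1 w hw g).val : GL (Fin 3) (w.1.adicCompletion L)) * T⁻¹ :=
    fun g => (congrArg (fun x : ↥(unitaryGroupOfForm (galAdicCompletionMap (L := L) (IsCMField.complexConj L) hw)
        (placeForm (Matrix.of fun i j : Fin 3 => if i.val + j.val + 1 = 3 then (1 : L) else 0) w.1)) => (x.val : GL (Fin 3) (w.1.adicCompletion L)))
          (ContinuousMulEquiv.trans_apply _ _ g)).trans
      (localNonsplitEquiv_localNonsplitCongr (IsCMField.complexConj L) hc1 w hw T isUnit_one hF g)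
  have hlev : ∀ g, g ∈ cmLocalIntegralLevel L 3 H' v ↔ ((e g).val : GL (Fin 3) (w.1.adicCompletion L)) ∈ glInt 3 (w.1.adicCompletion L) :=
    fun g => (hform g).symm ▸ mem_cmLocalIntegralLevel_iff_conj_mem_glInt L H' w hw hTint g
  have hcoe : ∀ g : (cmDatum L 3 H').Local v, (((localNonsplitEquiv (IsCMField.complexConj L) H' hc1 w hw g :
      ↥(unitaryGroupOfForm (galAdicCompletionMap (L := L) (IsCMField.complexConj L) hw) (placeForm H' w.1))) : GL (Fin 3) (w.1.adicCompletion L)) :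
        Matrix (Fin 3) (Fin 3) (w.1.adicCompletion L)) = ((g.val : GL (Fin 3) (LocalRing L v)).val).map ev := fun g => rfl
  have hxw : ∀ g : (cmDatum L 3 H').Local v, g ∈ cmLocalIntegralLevel L 3 H' v →
      ((localNonsplitEquiv (IsCMField.complexConj L) H' hc1 w hw g).val : GL (Fin 3) (w.1.adicCompletion L)) ∈ glInt 3 (w.1.adicCompletion L) :=
    fun g hg => (mem_localIntegralLevel_iff_of_smul_eq (IsCMField.complexConj L) 3 H' hc1 w hw g).1 hg
  -- the Jordan rank is read on `K_v` only, where the frame conjugates by `T⁻¹ ∈ GL₃(𝒪_w)`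
  have hR : ∀ g : (cmDatum L 3 H').Local v, g ∈ cmLocalIntegralLevel L 3 H' v →
      ((redMat (((g.val : GL (Fin 3) (LocalRing L v)).val).map ev) - 1).rank = 0 ↔
        (redMat ((((e g).val : GL (Fin 3) (w.1.adicCompletion L))) : Matrix (Fin 3) (Fin 3) (w.1.adicCompletion L)) - 1).rank = 0) := by
    intro g hg
    have key : ((e g).val : GL (Fin 3) (w.1.adicCompletion L)) =
        (T⁻¹)⁻¹ * ((localNonsplitEquiv (IsCMField.complexConj L) H' hc1 w hw g).val : GL (Fin 3) (w.1.adicCompletion L)) * T⁻¹ := by rw [inv_inv, hform g]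
    rw [key, rank_redMat_conj_sub_one_eq (inv_mem hTint) (hxw g hg), hcoe g]
  -- ### (2) transport of the stratum along `e` (★ `ncard_fixedBy_sep_congr`, the predicate carrying the `K`-membership it is read on)
  have hK : ∀ g : (cmDatum L 3 H').Local v, g ∈ cmLocalIntegralLevel L 3 H' v ↔ e.toMulEquiv g ∈
      (glInt 3 (w.1.adicCompletion L)).subgroupOf (unitaryGroupOfForm σ (placeForm (Matrix.of fun i j : Fin 3 => if i.val + j.val + 1 = 3 then (1 : L) else 0) w.1)) :=
    fun g => by rw [Subgroup.mem_subgroupOf]; exact hlev g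
  have hset : {q : (cmDatum L 3 H').Local v ⧸ cmLocalIntegralLevel L 3 H' v |
        q ∈ MulAction.fixedBy ((cmDatum L 3 H').Local v ⧸ cmLocalIntegralLevel L 3 H' v) δ ∧
          (redMat ((((q.out⁻¹ * δ * q.out : (cmDatum L 3 H').Local v)).val : GL (Fin 3) (LocalRing L v)).val.map ev) - 1).rank = 0} =
      {q : (cmDatum L 3 H').Local v ⧸ cmLocalIntegralLevel L 3 H' v |
        q ∈ MulAction.fixedBy ((cmDatum L 3 H').Local v ⧸ cmLocalIntegralLevel L 3 H' v) δ ∧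
          ((q.out⁻¹ * δ * q.out : (cmDatum L 3 H').Local v) ∈ cmLocalIntegralLevel L 3 H' v ∧
            (redMat ((((q.out⁻¹ * δ * q.out : (cmDatum L 3 H').Local v)).val : GL (Fin 3) (LocalRing L v)).val.map ev) - 1).rank = 0)} := by
    ext q
    simp only [Set.mem_setOf_eq]
    refine ⟨fun ⟨hq, hr⟩ => ⟨hq, ?_, hr⟩, fun ⟨hq, _, hr⟩ => ⟨hq, hr⟩⟩
    rw [← QuotientGroup.out_eq' q] at hq
    exact (mem_fixedBy_quotient_mk_iff (cmLocalIntegralLevel L 3 H' v) δ q.out).1 hq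
  have step1 := ncard_fixedBy_sep_congr (cmLocalIntegralLevel L 3 H' v)
    ((glInt 3 (w.1.adicCompletion L)).subgroupOf (unitaryGroupOfForm σ (placeForm (Matrix.of fun i j : Fin 3 => if i.val + j.val + 1 = 3 then (1 : L) else 0) w.1)))
    e.toMulEquiv hK δ
    (fun g => g ∈ cmLocalIntegralLevel L 3 H' v ∧ (redMat (((g.val : GL (Fin 3) (LocalRing L v)).val).map ev) - 1).rank = 0)
    (fun y => y ∈ (glInt 3 (w.1.adicCompletion L)).subgroupOf (unitaryGroupOfForm σ (placeForm (Matrix.of fun i j : Fin 3 => if i.val + j.val + 1 = 3 then (1 : L) else 0) w.1)) ∧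
      (redMat (((y : ↥(unitaryGroupOfForm σ (placeForm (Matrix.of fun i j : Fin 3 => if i.val + j.val + 1 = 3 then (1 : L) else 0) w.1))) :
        GL (Fin 3) (w.1.adicCompletion L)) : Matrix (Fin 3) (Fin 3) (w.1.adicCompletion L)) - 1).rank = 0)
    (fun g => ⟨fun ⟨hg, hr⟩ => ⟨(hK g).1 hg, (hR g hg).1 hr⟩, fun ⟨hg, hr⟩ => ⟨(hK g).2 hg, (hR g ((hK g).2 hg)).2 hr⟩⟩)
    (fun k' hk' y hy => by
      rw [Subgroup.mem_subgroupOf] at hk' hy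
      refine and_congr ⟨fun _ => Subgroup.mem_subgroupOf.2 hy, fun _ => Subgroup.mem_subgroupOf.2 ?_⟩ (rank_redMat_coe_conj_sub_one_eq_iff _ hk' hy 0)
      rw [Subgroup.coe_mul, Subgroup.coe_mul, Subgroup.coe_inv]
      exact mul_mem (mul_mem (inv_mem hk') hy) hk')
  -- ### (3) the strata dictionary on `U ⧸ (U ∩ GL₃(𝒪_w))` (2-free inputs: `L₀` self-dual, `U` transitive), rank `0` = the level-one token
  have hJ0 : placeForm (Matrix.of fun i j : Fin 3 => if i.val + j.val + 1 = 3 then (1 : L) else 0) w.1 =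
      (StdForm.antidiagonal 3).over (w.1.adicCompletion L) := by rw [placeForm_antidiagOne]
  have hJ0det : (placeForm (Matrix.of fun i j : Fin 3 => if i.val + j.val + 1 = 3 then (1 : L) else 0) w.1).det ≠ 0 := by
    rw [hJ0]; exact ((Matrix.isUnit_iff_isUnit_det _).1 ((StdForm.antidiagonal 3).isUnit_over _)).ne_zero
  have hL₀ : IsSelfDualLattice σ ϖ (placeForm (Matrix.of fun i j : Fin 3 => if i.val + j.val + 1 = 3 then (1 : L) else 0) w.1)
      (stdLattice (w.1.adicCompletion L) 3) := by
    rw [hJ0]; exact isSelfDualLattice_stdLattice_three_of_v hϖ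
  have htrace : ∃ t : w.1.adicCompletion L, Valued.v t ≤ 1 ∧ t + σ t = 1 := by
    let σO := (galAdicCompletionMap (L := L) (IsCMField.complexConj L) hw).restrict (ValuativeRel.valuation (w.1.adicCompletion L)).integer _
      fun x hx => galAdicCompletionMap_mem_integer (IsCMField.complexConj L) w hw hx
    obtain ⟨t, ht1⟩ := exists_add_map_eq_one_integer (IsCMField.complexConj L) w hc1 hw hv σO (fun _ => rfl) fun x => Subtype.ext (hσσ x)
    exact ⟨t, (v_le_one_iff_mem_integer (t : w.1.adicCompletion L)).2 t.2, congrArg Subtype.val ht1⟩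
  have htrans : ∀ M : Submodule (Valued.integer (w.1.adicCompletion L)) (Fin 3 → w.1.adicCompletion L),
      IsSelfDualLattice σ ϖ (placeForm (Matrix.of fun i j : Fin 3 => if i.val + j.val + 1 = 3 then (1 : L) else 0) w.1) M →
        ∃ u : ↥(unitaryGroupOfForm σ (placeForm (Matrix.of fun i j : Fin 3 => if i.val + j.val + 1 = 3 then (1 : L) else 0) w.1)),
          M = mapGL ((u : ↥(unitaryGroupOfForm σ (placeForm (Matrix.of fun i j : Fin 3 => if i.val + j.val + 1 = 3 then (1 : L) else 0) w.1))) :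
            GL (Fin 3) (w.1.adicCompletion L)) (stdLattice (w.1.adicCompletion L) 3) := by
    rw [hJ0]
    intro M hM
    obtain ⟨u, hu⟩ := exists_unitary_mapGL_stdLattice_eq_of_isSelfDualLattice_of_trace hσσ hvσ hϖ htrace hM
    exact ⟨u, hu.symm⟩
  have step2 := ncard_fixedBy_quotient_sep_eq_ncard_selfDual_fixed_sep σ ϖ _ hL₀ htrans (e δ)
    (fun y => y ∈ (glInt 3 (w.1.adicCompletion L)).subgroupOf (unitaryGroupOfForm σ (placeForm (Matrix.of fun i j : Fin 3 => if i.val + j.val + 1 = 3 then (1 : L) else 0) w.1)) ∧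
      (redMat (((y : ↥(unitaryGroupOfForm σ (placeForm (Matrix.of fun i j : Fin 3 => if i.val + j.val + 1 = 3 then (1 : L) else 0) w.1))) :
        GL (Fin 3) (w.1.adicCompletion L)) : Matrix (Fin 3) (Fin 3) (w.1.adicCompletion L)) - 1).rank = 0)
    (fun M => M.map ((Matrix.toLin' ((((e δ).val : GL (Fin 3) (w.1.adicCompletion L)) : Matrix (Fin 3) (Fin 3) (w.1.adicCompletion L)) - 1)).restrictScalars
      (Valued.integer (w.1.adicCompletion L))) ≤ scaleLattice ϖ M)
    (fun g hmem => by
      have hu : (((g : ↥(unitaryGroupOfForm σ (placeForm (Matrix.of fun i j : Fin 3 => if i.val + j.val + 1 = 3 then (1 : L) else 0) w.1))) :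
          GL (Fin 3) (w.1.adicCompletion L)))⁻¹ * ((e δ).val : GL (Fin 3) (w.1.adicCompletion L)) * (g : GL (Fin 3) (w.1.adicCompletion L)) ∈
            glInt 3 (w.1.adicCompletion L) := by
        rw [Subgroup.coe_mul, Subgroup.coe_mul, Subgroup.coe_inv] at hmem; exact hmem
      rw [and_iff_right (Subgroup.mem_subgroupOf.2 hmem), Subgroup.coe_mul, Subgroup.coe_mul, Subgroup.coe_inv]
      exact rank_redMat_sub_one_eq_zero_iff_map_sub_one_le hϖ hu)
  -- ### (4) `eδ·M = M ⟺ eδ·M ⊆ M` (`|det| = 1`, `χ` integral since `δ` is deep), and the frame matrix `T δ_w T⁻¹`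
  have hdet := v_det_eq_one_of_mem_unitaryGroupOfForm hvσ hJ0det (e δ).2
  have hmat : (((e δ).val : GL (Fin 3) (w.1.adicCompletion L)) : Matrix (Fin 3) (Fin 3) (w.1.adicCompletion L)) =
      (T : Matrix (Fin 3) (Fin 3) (w.1.adicCompletion L)) *
        ((δ.val : GL (Fin 3) (UnitaryGroup.LocalRing L v)) : Matrix (Fin 3) (Fin 3) (UnitaryGroup.LocalRing L v)).map ev *
        ((T⁻¹ : GL (Fin 3) (w.1.adicCompletion L)) : Matrix (Fin 3) (Fin 3) (w.1.adicCompletion L)) := by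
    rw [hform δ, Units.val_mul, Units.val_mul]
    rfl
  have hint : ∀ i, ((((e δ).val : GL (Fin 3) (w.1.adicCompletion L))) : Matrix (Fin 3) (Fin 3) (w.1.adicCompletion L)).charpoly.coeff i ∈
      Valued.integer (w.1.adicCompletion L) := by
    intro i
    rw [hmat, Matrix.coe_units_inv, Matrix.charpoly_units_conj, valuedInteger_eq_integer, ← hcoe δ]
    exact charpoly_coeff_mem_integer_of_deep
      ((localNonsplitEquiv (IsCMField.complexConj L) H' hc1 w hw δ :
        ↥(unitaryGroupOfForm (galAdicCompletionMap (L := L) (IsCMField.complexConj L) hw) (placeForm H' w.1))) :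
          GL (Fin 3) (w.1.adicCompletion L)) ht i
  rw [hset, step1]
  -- `e.toMulEquiv δ` is `e δ` by `rfl`
  calc _ = _ := step2
    _ = _ := by
      congr 1
      ext M
      simp only [Set.mem_setOf_eq]
      rw [mapGL_eq_iff_map_le_of_charpoly_coeff_mem M hdet hint, hmat, hJ0]

end Literature.NumberTheory.Rogawski1990

end
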